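import Literature.NumberTheory.LFunctions.FordProgram1
import HarnessLib

/-!
# Ford's "Program 1": kernel run 26A (`922 ≤ k ≤ 930`)

Topic `Literature/NumberTheory/LFunctions`. Everything here is PROVED (kernel evaluations, standard
axioms): `FordP1.checkT k = true` for `922 ≤ k ≤ 930`, i.e. the certified re-run of PROGRAM 1 of
K. Ford, Proc. LMS 85 (2002) (the second part of Theorem 3) for these `k` — see `FordProgram1.lean`
for the checker, its soundness `FordP1.row_of_checkK`, and the meaning of the constants
(`ρ = FordP1.rhoOf k / 10⁵`, `θ = FordP1.thetaOf k / 10⁴`, `ω = FordP1.omOf k / 10⁴`). One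
`decide +kernel` per `k` (so that the kernel's evaluation state is bounded by a single run;
`maxHeartbeats 0` lifts the deterministic time-out for each), then the range statement
`FordP1.run26A`. This is the first half of run 26 (`922 ≤ k ≤ 939`); the second half and the
`List.all` statement `FordP1.run26` consumed by the assembly `FordTheorem3SmallK.lean` are in
`FordProgram1Run26.lean`, which imports this file.

## References

* K. Ford, Proc. London Math. Soc. (3) 85 (2002), 565–633; arXiv:1910.08209: Theorem 3, (1.7),
  Lemmas 3.4–3.5, Appendix "PROGRAM 1". [Ford2002]
-/

namespace Literature.NumberTheory.LFunctions
namespace FordP1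

set_option maxHeartbeats 0 in
/-- `checkT 922`. [cite: Ford2002, Theorem 3 (second part) and PROGRAM 1] -/
theorem checkT_922 : checkT 922 = true := by
  decide +kernel

set_option maxHeartbeats 0 in
/-- `checkT 923`. [cite: Ford2002, Theorem 3 (second part) and PROGRAM 1] -/
theorem checkT_923 : checkT 923 = true := by
  decide +kernel

set_option maxHeartbeats 0 in
/-- `checkT 924`. [cite: Ford2002, Theorem 3 (second part) and PROGRAM 1] -/
theorem checkT_924 : checkT 924 = true := by
  decide +kernel

set_option maxHeartbeats 0 in
/-- `checkT 925`. [cite: Ford2002, Theorem 3 (second part) and PROGRAM 1] -/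
theorem checkT_925 : checkT 925 = true := by
  decide +kernel

set_option maxHeartbeats 0 in
/-- `checkT 926`. [cite: Ford2002, Theorem 3 (second part) and PROGRAM 1] -/
theorem checkT_926 : checkT 926 = true := by
  decide +kernel

set_option maxHeartbeats 0 in
/-- `checkT 927`. [cite: Ford2002, Theorem 3 (second part) and PROGRAM 1] -/
theorem checkT_927 : checkT 927 = true := by
  decide +kernel

set_option maxHeartbeats 0 in
/-- `checkT 928`. [cite: Ford2002, Theorem 3 (second part) and PROGRAM 1] -/
theorem checkT_928 : checkT 928 = true := by
  decide +kernel

set_option maxHeartbeats 0 in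
/-- `checkT 929`. [cite: Ford2002, Theorem 3 (second part) and PROGRAM 1] -/
theorem checkT_929 : checkT 929 = true := by
  decide +kernel

set_option maxHeartbeats 0 in
/-- `checkT 930`. [cite: Ford2002, Theorem 3 (second part) and PROGRAM 1] -/
theorem checkT_930 : checkT 930 = true := by
  decide +kernel

/-- **Kernel run 26A**: `checkT k` for `922 ≤ k ≤ 930`. [cite: Ford2002, Theorem 3 (second part)
and PROGRAM 1] -/
theorem run26A (k : ℕ) (h1 : 922 ≤ k) (h2 : k ≤ 930) : checkT k = true := by
  interval_cases k
  · exact checkT_922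
  · exact checkT_923
  · exact checkT_924
  · exact checkT_925
  · exact checkT_926
  · exact checkT_927
  · exact checkT_928
  · exact checkT_929
  · exact checkT_930

end FordP1
end Literature.NumberTheory.LFunctions
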